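import Summits.CriticalPhenomena.SAWScalingLimit.Theses.SAWChargeContinuation
import HarnessLib.Audit

/-!
# Birth skeleton (BC3) for the crux `ChargeAnalyticity` (stmt-CriticalPhenomena-11193)

Route `SAWChargeContinuation` of `CriticalPhenomena/SAWScalingLimit`, crux r3 = step (U):
"for every ε and window fugacity `y_W` realising the window law (the hypothesis is literally the
body of `WindowAvoidanceLaw`) there are an open connected `N ⊇ [0,1]` and a holomorphic `y` on `N`
with `y = y_W` on `[1−ε,1]`, `y 0 = x_c`, such that for every Dobrushin `D`, hull subdomain `D'`
and endpoint approximation there is `C` with: eventually in `δ`, `s ↦ R_δ(s, y s)` restricted to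
`[0,1]` is the trace of a holomorphic `g_δ` on `N` with `|g_δ| ≤ C`" (no phase transition in the
loop-soup charge along the critical curve).

The crux is an `∀ ε yW, 0 < ε → Window(ε,yW) → ∃ N y, Curve(N,y) ∧ RatioNormal(N,y)` statement.
We name its pieces (all definitionally the inlined `let`s of the route file; `chargeAnalyticity_iff`
below is `Iff.rfl`): `hull`, `pb`, `G`, `m`, `Z`, `α` verbatim; `R` the avoidance ratio
`Z(D_δ|D'; s, y)/Z(D_δ; s, y)`; `WindowLaw ε yW` the hypothesis; `RatioNormal N y` the conclusion's
last clause.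

## The line = the route header's foreseen glued split
"ChargeAnalyticity ⇐ BulkPressureAnalytic → RatioBoundedGivenBulk", cut along its two mechanisms
(2 registered stubs):

* `stub_analyticChargeCurve` (BulkPressureAnalytic, OUTPUT form) — the window fugacity `y_W|[1−ε,1]`
  is real-analytic and its analytic continuation runs along the whole charge segment and lands on
  the SAW point: there are an open connected `N ⊇ [0,1]` and `y` holomorphic on `N`, `y = y_W` on
  the window, `y 0 = x_c`, and `y` real and positive on `[0,1]` (the critical curve
  `y_c(s) = e^{−π(s)}` of the Kozdron–Lawler λ-SAW family, `π` = half-plane pressure of the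
  `s`-tilted walk, interpolating LERW `y_c(1) = 1/4` and SAW `y_c(0) = x_c`).  NO claim about the
  finite-domain ratios.  Why it might fail: `y_c` may be non-analytic somewhere on `[0,1]` (a phase
  transition of the bulk tilted walk in the charge), the continuation may hit a natural boundary
  before `s = 0`, or land at `y(0) ≠ x_c`; even existence of a critical `y_c(s)` with a power-law
  window is only K–L's conjecture (KozdronLawler2007 §6, KennedyLawler2013 §1.1).
* `stub_ratioNormalFamily` (RatioBoundedGivenBulk) — GIVEN such an analytic charge curve `(N, y)`
  through a window fugacity realising the window law (by the identity theorem `y` is pinned by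
  `y_W`: it IS the continued critical curve), the avoidance ratios `R_δ(·, y ·)|[0,1]` are, eventually
  in `δ`, traces of holomorphic functions on a possibly smaller open connected `N' ⊇ [0,1]`,
  `N' ⊆ N`, chosen BEFORE `(D, D', a, b)`, bounded by `C(D, D', a, b)` uniformly in `δ` (the complex-`s`
  Fisher/Lee–Yang zeros of `s ↦ Z(D_δ; s, y s)` stay off `N'` or cancel in the ratio; Montel
  normality of `{g_δ}`).  Why it might fail: criticality holds on the whole segment, so the zeros of
  the denominator may pinch `[0,1]` as `δ → 0` without cancelling (only the extensive phases cancel,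
  `(log y_c)'' = −Var(m)/n`; the macroscopic ones are uncontrolled) — the sharpened risk recorded by
  the crux-attack refuter (evidence EVIDENCE_ChargeAnalyticity.md v2, Kim–Creswick analogy).

`ChargeAnalyticity_of` is the kernel-checked composition (sorry-free; sorries live only in the two
`stub_*`): the curve stub produces `(N, y)`, the normality stub shrinks `N` to `N'` and bounds the
ratios there; `y` restricted to `N'` (`DifferentiableOn.mono`) keeps its window values and
`y 0 = x_c`, and `N'` is the neighbourhood the crux asks for.

Disproof / negatives used: no `Disproof.lean` and no `Negative/` lemma exist for this crux at
registration (`ledger crux ls stmt-CriticalPhenomena-11193`: no workfiles); `ledger negatives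
--problem CriticalPhenomena`: no entry concerns tilted partition functions, analytic continuation
in a parameter, or fugacity curves (nearest: stmt-0772, tightness over ALL meshes — unrelated; no
`δ`-quantifier here leaves `𝓝[>] 0`).  The crux-attack report (refuter, 2026-08-15, survives)
certifies the junk audit this file inherits: `Z`, `m` are finite/summable sums, `x/0` only if
`y t = 0`, `ε ≥ 1` / `ε > 3/2` degeneracies are hypothesis-side only.
-/

noncomputable section

namespace Summit.CriticalPhenomena.SAWScalingLimit.Cruxes.ChargeAnalyticity.Birth

-- same `open`s as the route file, so that the vocabulary below elaborates to the route's terms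
open scoped BigOperators Topology Manifold Classical MeasureTheory ProbabilityTheory Matrix InnerProductSpace ComplexConjugate ContinuousMap
open Filter Set Function TopologicalSpace MeasureTheory
open Literature.Probability.LatticeModels Literature.Probability.RandomPlanarGeometry

open Summit.CriticalPhenomena.SAWScalingLimit.Theses.SAWChargeContinuation (ChargeAnalyticity)

/-! ### 1. Vocabulary shared by the stubs (verbatim pieces of the route decl) -/

/-- `D'` is a hull subdomain of `D` (the route's inlined `hull`; `= MarkedDomain.IsHullSubdomain`). -/
def hull (D D' : DobrushinDomain) : Prop :=
  D'.carrier ⊆ D.carrier ∧ D'.pt 0 = D.pt 0 ∧ D'.pt 1 = D.pt 1 ∧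
    D.pt 0 ∉ closure (D.carrier \ D'.carrier) ∧ D.pt 1 ∉ closure (D.carrier \ D'.carrier)

/-- The pulled-back hull `A = cl(ℍ ∖ φ⁻¹ D')` (the route's inlined `pb`; `= ConformalEquiv.pullbackHull`). -/
def pb (D : DobrushinDomain) (φ : ConformalEquiv UpperHalfPlane.upperHalfPlaneSet D.carrier)
    (D' : DobrushinDomain) : Set ℂ :=
  closure (UpperHalfPlane.upperHalfPlaneSet \
    {z | z ∈ UpperHalfPlane.upperHalfPlaneSet ∧ φ z ∈ D'.carrier})

/-- The `Ω'`-sub-graph of the discrete domain `Ω_δ` (the route's inlined `G`).  An `abbrev`: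
in the route file `G` is a `let`, through which instance search sees `SimpleGraph.fromRel` when it
elaborates the `Decidable` instance of the `if` in `Z`; a reducible `G` reproduces that instance,
so that `chargeAnalyticity_iff` is `Iff.rfl` (with an opaque `def G` it is not). -/
abbrev G (Ω Ω' : Set ℂ) (δ : ℝ) : SimpleGraph (Site 2) :=
  SimpleGraph.fromRel fun x y => (discreteDomainGraph Ω δ).Adj x y ∧ (meshGraph Ω' δ).Adj x y ∧
    x ∈ meshVertices Ω' δ ∧ y ∈ meshVertices Ω' δ

/-- Rooted random-walk loop measure (weight `4^{-n}/n`) of the loops of the `Ω'`-sub-graph meeting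
`γ` (the route's inlined `m`; Kennedy–Lawler §1.1). -/
def m (Ω Ω' : Set ℂ) (δ : ℝ) (a b : Site 2) (γ : SAW.DomainSAW Ω δ a b) : ℝ :=
  ∑' p : (Σ x : Site 2, (G Ω Ω' δ).Walk x x),
    if 0 < p.2.length ∧ (∃ v ∈ p.2.support, v ∈ γ.walk.support) then
      (1 / 4 : ℝ) ^ p.2.length / (p.2.length : ℝ) else 0

/-- The tilted partition function `Z(Ω_δ|Ω'; s, y) = Σ_γ y^|γ| e^{s·m(γ)}` over SAWs `a → b` of
`Ω_δ` using only edges of the `Ω'`-sub-graph, for complex charge `s` and fugacity `y` (the route's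
inlined `Z`; Kozdron–Lawler §6). -/
def Z (Ω Ω' : Set ℂ) (δ : ℝ) (a b : Site 2) (s y : ℂ) : ℂ :=
  ∑' γ : SAW.DomainSAW Ω δ a b,
    if (∀ e ∈ γ.walk.darts, (G Ω Ω' δ).Adj e.fst e.snd) then
      y ^ γ.length * Complex.exp (s * (m Ω Ω' δ a b γ : ℂ)) else 0

/-- The restriction exponent `α(s) = (6−κ)/2κ` at central charge `−2s` (the route's inlined `α`). -/
def α (s : ℝ) : ℝ :=
  (5 + 2 * s + Real.sqrt ((13 + 2 * s) ^ 2 - 144)) / 16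

/-- The avoidance ratio `R_δ(s, y) = Z(D_δ|D'; s, y) / Z(D_δ; s, y)` for the data `(D, D', a, b)`. -/
def R (D D' : DobrushinDomain) (a b : ℝ → Site 2) (δ : ℝ) (s y : ℂ) : ℂ :=
  Z D.carrier D'.carrier δ (a δ) (b δ) s y / Z D.carrier D.carrier δ (a δ) (b δ) s y

/-- **Window law** for `(ε, y_W)`: the hypothesis of the crux, literally the body of
`WindowAvoidanceLaw` (`y_W(1) = 1/4`, `y_W > 0` on `[1−ε,1]`, and `R_δ(s, y_W s) → d^{α(s)}` for all
restriction data). -/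
def WindowLaw (ε : ℝ) (yW : ℝ → ℝ) : Prop :=
  yW 1 = 1 / 4 ∧ ∀ s ∈ Set.Icc (1 - ε) 1, 0 < yW s ∧
    ∀ (D D' : DobrushinDomain), hull D D' → ∀ (a b : ℝ → Site 2), SAW.IsEndpointApprox D a b →
      ∀ (φ : ConformalEquiv UpperHalfPlane.upperHalfPlaneSet D.carrier), D.IsChordalUniformizing φ →
        ∀ (Φ : ConformalEquiv (UpperHalfPlane.upperHalfPlaneSet \ pb D φ D')
          UpperHalfPlane.upperHalfPlaneSet) (d : ℝ),
          IsRestrictionMap (pb D φ D') Φ → HasRestrictionDeriv (pb D φ D') Φ d →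
            Tendsto (fun δ => R D D' a b δ s (yW s)) (𝓝[>] 0) (𝓝 ((d ^ (α s) : ℝ) : ℂ))

/-- **Uniform bounded holomorphy of the avoidance ratios on `N` along the curve `y`**: the last
clause of the crux's conclusion (`N` fixed before `(D, D', a, b)`, `C` before `δ`, `g_δ` holomorphic
on `N`, bounded by `C` on `N`, equal to `R_δ(t, y t)` for `t ∈ [0,1]`). -/
def RatioNormal (N : Set ℂ) (y : ℂ → ℂ) : Prop :=
  ∀ (D D' : DobrushinDomain), hull D D' → ∀ (a b : ℝ → Site 2), SAW.IsEndpointApprox D a b →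
    ∃ C : ℝ, ∀ᶠ δ in 𝓝[>] 0, ∃ g : ℂ → ℂ, DifferentiableOn ℂ g N ∧ (∀ s ∈ N, ‖g s‖ ≤ C) ∧
      ∀ t ∈ Set.Icc (0 : ℝ) 1, g t = R D D' a b δ t (y t)

/-- **Analytic charge curve through the window**: `N` open connected `⊇ [0,1]`, `y` holomorphic on
`N`, `y = y_W` on `[1−ε,1]`, `y 0 = x_c`, and `y` real and positive on the charge segment `[0,1]`
(the interface between the two stubs: what the bulk stub delivers and the ratio stub consumes). -/
def IsChargeCurve (ε : ℝ) (yW : ℝ → ℝ) (N : Set ℂ) (y : ℂ → ℂ) : Prop :=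
  IsOpen N ∧ IsConnected N ∧ (∀ t ∈ Set.Icc (0 : ℝ) 1, (t : ℂ) ∈ N) ∧ DifferentiableOn ℂ y N ∧
    (∀ t ∈ Set.Icc (1 - ε) 1, y t = yW t) ∧ y 0 = (SAW.criticalFugacity : ℂ) ∧
    ∀ t ∈ Set.Icc (0 : ℝ) 1, ∃ r : ℝ, 0 < r ∧ y t = (r : ℂ)

/-- `ChargeAnalyticity` IS `∀ ε yW, 0 < ε → WindowLaw ε yW → ∃ N, … ∃ y, … ∧ RatioNormal N y`,
verbatim (the route's `let`s zeta-reduce to the vocabulary above). -/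
theorem chargeAnalyticity_iff :
    ChargeAnalyticity ↔
      ∀ (ε : ℝ) (yW : ℝ → ℝ), 0 < ε → WindowLaw ε yW →
        ∃ N : Set ℂ, IsOpen N ∧ IsConnected N ∧ (∀ t ∈ Set.Icc (0 : ℝ) 1, (t : ℂ) ∈ N) ∧
          ∃ y : ℂ → ℂ, DifferentiableOn ℂ y N ∧ (∀ t ∈ Set.Icc (1 - ε) 1, y t = yW t) ∧
            y 0 = (SAW.criticalFugacity : ℂ) ∧ RatioNormal N y :=
  Iff.rfl

/-! ### 2. Registered stubs (the ONLY sorries of this file) -/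

/-- **stub 1 — BulkPressureAnalytic (analytic charge curve).** For every window `(ε, y_W)`
realising the window law there is an analytic charge curve through it: an open connected
`N ⊇ [0,1]` and `y` holomorphic on `N` with `y = y_W` on `[1−ε,1]`, `y 0 = x_c`, `y` real and
positive on `[0,1]` (the Kozdron–Lawler critical fugacity `y_c(s) = e^{−π(s)}` is real-analytic on
the whole charge segment and joins LERW `y_c(1) = 1/4` to SAW `y_c(0) = x_c`; KozdronLawler2007 §6,
KennedyLawler2013 §1.1). -/
theorem stub_analyticChargeCurve : ∀ (ε : ℝ) (yW : ℝ → ℝ), 0 < ε → WindowLaw ε yW →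
    ∃ (N : Set ℂ) (y : ℂ → ℂ), IsChargeCurve ε yW N y := by
  sorry

/-- **stub 2 — RatioBoundedGivenBulk (no phase transition in the charge along the curve).**
Given an analytic charge curve `(N, y)` through a window fugacity realising the window law, there
is a smaller open connected `N' ⊇ [0,1]` inside `N` on which, for every `(D, D', a, b)`, the
avoidance ratios `R_δ(·, y ·)|[0,1]` are eventually traces of holomorphic functions bounded
uniformly in `δ` (complex-charge zeros of `Z(D_δ; s, y s)` stay off `N'` or cancel in the ratio;
Montel/Lee–Yang input; KozdronLawler2007 §6, DuminilCopinKozmaYadin2014 for the off-critical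
degeneration that pins `y`). -/
theorem stub_ratioNormalFamily : ∀ (ε : ℝ) (yW : ℝ → ℝ) (N : Set ℂ) (y : ℂ → ℂ),
    0 < ε → WindowLaw ε yW → IsChargeCurve ε yW N y →
      ∃ N' ⊆ N, IsOpen N' ∧ IsConnected N' ∧ (∀ t ∈ Set.Icc (0 : ℝ) 1, (t : ℂ) ∈ N') ∧
        RatioNormal N' y := by
  sorry

/-! ### 3. The composition (kernel-checked, no sorry of its own) -/

/-- **`ChargeAnalyticity` from the two stubs**, concluding the route decl BY NAME: the bulk stub
produces the analytic charge curve `(N, y)`; the ratio stub shrinks `N` to `N' ⊆ N` (still open,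
connected, `⊇ [0,1]`, chosen before `(D, D', a, b)`) and bounds the ratios there; `y|N'` is still
holomorphic (`DifferentiableOn.mono`), agrees with `y_W` on the window and has `y 0 = x_c`. -/
theorem ChargeAnalyticity_of :
    (∀ (ε : ℝ) (yW : ℝ → ℝ), 0 < ε → WindowLaw ε yW →
      ∃ (N : Set ℂ) (y : ℂ → ℂ), IsChargeCurve ε yW N y) →
    (∀ (ε : ℝ) (yW : ℝ → ℝ) (N : Set ℂ) (y : ℂ → ℂ),
      0 < ε → WindowLaw ε yW → IsChargeCurve ε yW N y →
        ∃ N' ⊆ N, IsOpen N' ∧ IsConnected N' ∧ (∀ t ∈ Set.Icc (0 : ℝ) 1, (t : ℂ) ∈ N') ∧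
          RatioNormal N' y) →
    Summit.CriticalPhenomena.SAWScalingLimit.Theses.SAWChargeContinuation.ChargeAnalyticity := by
  intro hCurve hNormal
  refine chargeAnalyticity_iff.2 fun ε yW hε hW => ?_
  obtain ⟨N, y, hNy⟩ := hCurve ε yW hε hW
  obtain ⟨N', hN'N, hN'open, hN'conn, hN'seg, hR⟩ := hNormal ε yW N y hε hW hNy
  obtain ⟨-, -, -, hy_diff, hy_window, hy_zero, -⟩ := hNy
  exact ⟨N', hN'open, hN'conn, hN'seg, y, hy_diff.mono hN'N, hy_window, hy_zero, hR⟩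

/-- The line applied to the registered stubs: `ChargeAnalyticity`, sorry-free except through
`stub_analyticChargeCurve` and `stub_ratioNormalFamily`. -/
theorem ChargeAnalyticity_proof :
    Summit.CriticalPhenomena.SAWScalingLimit.Theses.SAWChargeContinuation.ChargeAnalyticity :=
  ChargeAnalyticity_of stub_analyticChargeCurve stub_ratioNormalFamily

end Summit.CriticalPhenomena.SAWScalingLimit.Cruxes.ChargeAnalyticity.Birth

end
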